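import Summits.Ventures.QEC.CircuitDistance.ETowerZeros345DX
import HarnessLib

/-!
# P3-PORT STEP 2 (E-fold tower), sector X: ZERO-FIBRE COMPLETENESS CERTIFICATES, file 3 of 9 (PORT-SPEC N3; `goodFibK_zero` hypothesis `hD`)
(cell `qec`, experiment CDX; emitter idea-1 g5 `zerocert/emit_zeros2.py`; W = 10, half-words of weight ≤ 5)

Brute force anchored at the first slot `a = b·ls·ms` of each block `b < 5`: `zloopk M ok (M a) (2^a) (a+1) ns = true` says every
`k` further slots `ns > i₁ > … > i_k > a` with `M a ⊕ M i₁ ⊕ … ⊕ M i_k = 0` give a word matched in the D-list (`ok = matchedB ls ms 5 DX`);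
`zbandk … ilo ihi` = the same with the outer slot restricted to `[ilo, ihi)` (bands glued by `ETowerZeroCert.zspec_of_bands`).
6 theorems, 484345 leaves, ≈ 203 s predicted at 420 µs/leaf.  `decide +kernel` only; nothing here asserts a value of `d_circ`.
-/

set_option maxRecDepth 100000
set_option exponentiation.threshold 1024
set_option linter.unusedVariables false

namespace Summit.Ventures.QEC.CircuitDistance.ETower.Sec345X.Zeros

open Summit.Ventures.QEC.Census Summit.Ventures.QEC.Census.Fold Summit.Ventures.QEC.CircuitDistance.ETower

set_option maxHeartbeats 400000000 in
/-- level B, anchor slot 0 (block 0), 4 further slots from [1,90), outer slot in [78,79): 73150 leaves ≈ 31 s. -/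
theorem zcB_b0_k4_i78_79 : zbandK 4 (tab Sec345X.TFB 42) (matchedM 6 3 5 Sec345X.Zeros.DB) (tab Sec345X.TFB 42 0) (2 ^ 0) 1 78 79 = true := by
  decide +kernel

set_option maxHeartbeats 400000000 in
/-- level B, anchor slot 0 (block 0), 4 further slots from [1,90), outer slot in [79,80): 76076 leaves ≈ 32 s. -/
theorem zcB_b0_k4_i79_80 : zbandK 4 (tab Sec345X.TFB 42) (matchedM 6 3 5 Sec345X.Zeros.DB) (tab Sec345X.TFB 42 0) (2 ^ 0) 1 79 80 = true := by
  decide +kernel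

set_option maxHeartbeats 400000000 in
/-- level B, anchor slot 0 (block 0), 4 further slots from [1,90), outer slot in [80,81): 79079 leaves ≈ 33 s. -/
theorem zcB_b0_k4_i80_81 : zbandK 4 (tab Sec345X.TFB 42) (matchedM 6 3 5 Sec345X.Zeros.DB) (tab Sec345X.TFB 42 0) (2 ^ 0) 1 80 81 = true := by
  decide +kernel

set_option maxHeartbeats 400000000 in
/-- level B, anchor slot 0 (block 0), 4 further slots from [1,90), outer slot in [81,82): 82160 leaves ≈ 35 s. -/
theorem zcB_b0_k4_i81_82 : zbandK 4 (tab Sec345X.TFB 42) (matchedM 6 3 5 Sec345X.Zeros.DB) (tab Sec345X.TFB 42 0) (2 ^ 0) 1 81 82 = true := by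
  decide +kernel

set_option maxHeartbeats 400000000 in
/-- level B, anchor slot 0 (block 0), 4 further slots from [1,90), outer slot in [82,83): 85320 leaves ≈ 36 s. -/
theorem zcB_b0_k4_i82_83 : zbandK 4 (tab Sec345X.TFB 42) (matchedM 6 3 5 Sec345X.Zeros.DB) (tab Sec345X.TFB 42 0) (2 ^ 0) 1 82 83 = true := by
  decide +kernel

set_option maxHeartbeats 400000000 in
/-- level B, anchor slot 0 (block 0), 4 further slots from [1,90), outer slot in [83,84): 88560 leaves ≈ 37 s. -/
theorem zcB_b0_k4_i83_84 : zbandK 4 (tab Sec345X.TFB 42) (matchedM 6 3 5 Sec345X.Zeros.DB) (tab Sec345X.TFB 42 0) (2 ^ 0) 1 83 84 = true := by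
  decide +kernel

end Summit.Ventures.QEC.CircuitDistance.ETower.Sec345X.Zeros
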